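import Mathlib
import Summits.CriticalPhenomena.SAWScalingLimit.Theorems.SAWRestrictionRigidityAxiomsOfLimitMarkovTestFunctions
import Summits.CriticalPhenomena.SAWScalingLimit.Theorems.SAWRestrictionRigidityAxiomsOfLimitMarkovKernelPassage
import HarnessLib

/-!
# The `markov` clause at `(D, F)` from lattice data: composition of parts 1 and 2

Crux `AxiomsOfLimit` (stmt-CriticalPhenomena-1370), line `registered` (= `split`), stub `stub_markovOfLimit`:
CONTINUUM HALF of the Markov passage, part 3 (lead c3) — the two landed parts composed on `CurveClass ℂ`:

* part 1 (`…AxiomsOfLimitMarkovTestFunctions`, p150297): the `markov` clause of `ChordalFamily.IsMarkovExtension` at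
  `(D, F)` follows from the tensor test-function identity for the limit law;
* part 2 (`…AxiomsOfLimitMarkovKernelPassage`, p150449): the tensor identity passes from the lattice to the limit under
  joint convergence of (past, future) and continuous convergence of the conditional-future kernels along charged pasts.

`markov_clause_of_lattice_passage`: let `P` be a probability law on `CurveClass ℂ` (the limit `P D`), `F ⊆ ℂ` closed,
`κ` a sub-probability kernel (the candidate `Q D`), and let lattice curves `C n : Ωs n → CurveClass ℂ` under probability
laws `Ps n` (the critical SAW polylines at mesh `δ_n`) be given with sub-probability kernels `κs n` (conditional futures
given the `F`-stopped past, on the lattice an EXACT identity — tree `…ExcursionDomination.law_prefix_restrict`) such that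
(a) `(stopAt F, startFrom F) (C n) → (stopAt F, startFrom F)` under `P` in law [= `(lim)` + no grazing of `F`],
(b) the lattice tensor identities hold, (c) `κs → κ` continuously along charged pasts [= tip stability]. Then the
`markov` clause holds at `(D, F)` for all Borel `S, T`. This is the precise statement of "what the lattice side must
deliver" for the Markov conjunct of the crux at one closed set `F`.

References: W. Werner, *Lectures on two-dimensional critical percolation* (2007), §3.2 (2); G. F. Lawler, O. Schramm,
W. Werner, *On the scaling limit of planar self-avoiding walk* (2004), §2.3; P. Billingsley, *Convergence of
Probability Measures* (1999), Thm 2.7. All [folklore].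
-/

noncomputable section

open MeasureTheory ProbabilityTheory Filter Topology Set BoundedContinuousFunction
open scoped NNReal ENNReal

namespace Summit.CriticalPhenomena.SAWScalingLimit.Theorems.AxiomsOfLimitMarkov

open Literature.Probability.RandomPlanarGeometry

/-- **The `markov` clause at `(D, F)` from lattice data** (composition of `markov_clause_of_forall_integral` and
`integral_mul_eq_integral_mul_integral_kernel_of_tendsto` with `X = stopAt F`, `Y = startFrom F`). [folklore] -/
theorem markov_clause_of_lattice_passage (P : Measure (CurveClass ℂ)) [IsProbabilityMeasure P] {F : Set ℂ}
    (hF : IsClosed F) (κ : Kernel (CurveClass ℂ) (CurveClass ℂ)) (hκ : ∀ p, κ p univ ≤ 1)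
    {Ωs : ℕ → Type*} [∀ n, MeasurableSpace (Ωs n)] (Ps : ∀ n, Measure (Ωs n))
    [∀ n, IsProbabilityMeasure (Ps n)] (C : ∀ n, Ωs n → CurveClass ℂ) (hC : ∀ n, Measurable (C n))
    (hjoint : ∀ φ : CurveClass ℂ × CurveClass ℂ →ᵇ ℝ,
      Tendsto (fun n => ∫ ω, φ ((C n ω).stopAt F, (C n ω).startFrom F) ∂Ps n) atTop
        (𝓝 (∫ γ, φ (γ.stopAt F, γ.startFrom F) ∂P)))
    (κs : ℕ → Kernel (CurveClass ℂ) (CurveClass ℂ)) (hκs : ∀ n p, κs n p univ ≤ 1)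
    {K : ℕ → Set (CurveClass ℂ)} (hKm : ∀ n, MeasurableSet (K n))
    (hK : ∀ n, ∀ᵐ ω ∂Ps n, (C n ω).stopAt F ∈ K n)
    (hcont : ∀ g : CurveClass ℂ →ᵇ ℝ, ∀ᵐ p ∂(P.map (CurveClass.stopAt F)), ∀ u : ℕ → ℕ, StrictMono u →
      ∀ xs : ℕ → CurveClass ℂ, (∀ j, xs j ∈ K (u j)) → Tendsto xs atTop (𝓝 p) →
        Tendsto (fun j => ∫ η, g η ∂(κs (u j) (xs j))) atTop (𝓝 (∫ η, g η ∂(κ p))))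
    (hident : ∀ n (f g : CurveClass ℂ →ᵇ ℝ),
      ∫ ω, f ((C n ω).stopAt F) * g ((C n ω).startFrom F) ∂Ps n =
        ∫ ω, f ((C n ω).stopAt F) * (∫ η, g η ∂(κs n ((C n ω).stopAt F))) ∂Ps n)
    {S T : Set (CurveClass ℂ)} (hS : MeasurableSet S) (hT : MeasurableSet T) :
    P (CurveClass.stopAt F ⁻¹' S ∩ CurveClass.startFrom F ⁻¹' T) =
      ∫⁻ γ in CurveClass.stopAt F ⁻¹' S, κ (γ.stopAt F) T ∂P := by
  haveI : IsFiniteKernel κ := ⟨⟨1, ENNReal.one_lt_top, hκ⟩⟩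
  refine markov_clause_of_forall_integral P hF κ (fun f g => ?_) hS hT
  exact integral_mul_eq_integral_mul_integral_kernel_of_tendsto
    (X := fun n ω => (C n ω).stopAt F) (Y := fun n ω => (C n ω).startFrom F)
    (X₀ := CurveClass.stopAt F) (Y₀ := CurveClass.startFrom F) (μ := P)
    (fun n => (CurveClass.measurable_stopAt hF).comp (hC n)) (CurveClass.measurable_stopAt hF) hjoint κs κ
    hκs hκ hKm hK (hcont g) (fun n => hident n f g)

/-! ### Registered sub-goal of crux stmt-CriticalPhenomena-1370 (line `registered`, stub `stub_markovOfLimit`) -/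

/-- **Registered sub-goal `stub_markovClauseOfLatticePassage`** (crux stmt-CriticalPhenomena-1370, continuum half of
the Markov passage, part 3): `markov_clause_of_lattice_passage` with all binders explicit, notation-free, lattice sample
spaces at universe level `0` (the level of `SAW.DomainSAW …`). [folklore] -/
theorem stub_markovClauseOfLatticePassage :
    ∀ (P : MeasureTheory.Measure (Literature.Probability.RandomPlanarGeometry.CurveClass ℂ)) [MeasureTheory.IsProbabilityMeasure P] (F : Set ℂ), IsClosed F → ∀ (κ : ProbabilityTheory.Kernel (Literature.Probability.RandomPlanarGeometry.CurveClass ℂ) (Literature.Probability.RandomPlanarGeometry.CurveClass ℂ)), (∀ p, κ p Set.univ ≤ 1) → ∀ (Ωs : ℕ → Type) [∀ n, MeasurableSpace (Ωs n)] (Ps : ∀ n, MeasureTheory.Measure (Ωs n)) [∀ n, MeasureTheory.IsProbabilityMeasure (Ps n)] (C : ∀ n, Ωs n → Literature.Probability.RandomPlanarGeometry.CurveClass ℂ), (∀ n, Measurable (C n)) → (∀ φ : BoundedContinuousFunction (Literature.Probability.RandomPlanarGeometry.CurveClass ℂ × Literature.Probability.RandomPlanarGeometry.CurveClass ℂ)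 ℝ, Filter.Tendsto (fun n => MeasureTheory.integral (Ps n) (fun ω => φ ((C n ω).stopAt F, (C n ω).startFrom F))) Filter.atTop (nhds (MeasureTheory.integral P (fun γ => φ (γ.stopAt F, γ.startFrom F))))) → ∀ (κs : ℕ → ProbabilityTheory.Kernel (Literature.Probability.RandomPlanarGeometry.CurveClass ℂ) (Literature.Probability.RandomPlanarGeometry.CurveClass ℂ)), (∀ n p, κs n p Set.univ ≤ 1) → ∀ (K : ℕ → Set (Literature.Probability.RandomPlanarGeometry.CurveClass ℂ)), (∀ n, MeasurableSet (K n)) → (∀ n, Filter.Eventually (fun ω => (C n ω).stopAt F ∈ K n) (MeasureTheory.ae (Ps n))) → (∀ g : BoundedContinuousFunction (Literature.Probability.RandomPlanarGeometry.CurveClass ℂ) ℝ, Filter.Eventually (fun p => ∀ u : ℕ → ℕ, StrictMono u → ∀ xs : ℕ → Literature.Probability.RandomPlanarGeometry.CurveClass ℂ, (∀ j, xs j ∈ K (u j)) → Filter.Tendsto xs Filter.atTop (nhds p) → Filter.Tendsto (fun j => MeasureTheory.integral (κs (u j) (xs j)) (fun η => g η)) Filter.atTop (nhds (MeasureTheory.integral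 (κ p) (fun η => g η)))) (MeasureTheory.ae (P.map (Literature.Probability.RandomPlanarGeometry.CurveClass.stopAt F)))) → (∀ n (f g : BoundedContinuousFunction (Literature.Probability.RandomPlanarGeometry.CurveClass ℂ) ℝ), MeasureTheory.integral (Ps n) (fun ω => f ((C n ω).stopAt F) * g ((C n ω).startFrom F)) = MeasureTheory.integral (Ps n) (fun ω => f ((C n ω).stopAt F) * MeasureTheory.integral (κs n ((C n ω).stopAt F)) (fun η => g η))) → ∀ S T : Set (Literature.Probability.RandomPlanarGeometry.CurveClass ℂ), MeasurableSet S → MeasurableSet T → P (Literature.Probability.RandomPlanarGeometry.CurveClass.stopAt F ⁻¹' S ∩ Literature.Probability.RandomPlanarGeometry.CurveClass.startFrom F ⁻¹' T) = MeasureTheory.lintegral (P.restrict (Literature.Probability.RandomPlanarGeometry.CurveClass.stopAt F ⁻¹' S)) (fun γ => κ (γ.stopAt F) T) :=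
  fun P _ _ hF κ hκ _ _ Ps _ C hC hjoint κs hκs _ hKm hK hcont hident _ _ hS hT =>
    markov_clause_of_lattice_passage P hF κ hκ Ps C hC hjoint κs hκs hKm hK hcont hident hS hT

end Summit.CriticalPhenomena.SAWScalingLimit.Theorems.AxiomsOfLimitMarkov

end
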